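import Mathlib
import Summits.Langlands.Langlands.Theorems.PhantomRMYoshidaStableYoshidaCongruenceModelFpDescent
import Literature.NumberTheory.GaloisRepresentations.FramedRepBaseChange
import HarnessLib

/-!
# Route `PhantomRMYoshida`, crux `StableYoshidaCongruence` (stmt-Langlands-13640), line
# `burkhardt-weddle-two-three-anchor`: Stub 1 `stub_modelFp`, part II — the Frobenius dichotomy and Case A

For a field `k` of characteristic `p` with the DISCRETE topology and continuous irreducible
`σ, σ' : G → GL₂(k)` whose products `det(X - σ(g)) det(X - σ'(g))` are Frobenius-invariant
(`𝔽_p`-rational), in the sub-namespace `ModelFp`: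

* `frobenius_dichotomy` (`k` perfect) — EITHER every `det(X - σ(g))` is `F`-invariant OR
  `F(det(X - σ(g))) = det(X - σ'(g))` for all `g`: Brauer–Nesbitt (tree
  `Representation.nonempty_equiv_of_charpoly_eq`) identifies `σ^F ⊕ σ'^F ≃ σ ⊕ σ'`, and Schur (Mathlib
  `Representation.IsIrreducible.bijective_or_eq_zero`) applied to `σ^F ↪ σ ⊕ σ' ↠ σ, σ'`;
* `exists_model_of_frobenius_fixed` — Case A: if both constituents are `F`-invariant, descend each to
  `GL₂(𝔽_p)` (Deligne–Serre 1974, Lemme 6.13 for `n = 2`, tree `exists_descent_fin_two`), take the block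
  sum (continuous: its kernel contains the open `ker σ ∩ ker σ'`) and conjugate its base change to
  `σ ⊕ σ'` (`exists_conj_blockDiag`);
* small lemmas: lifting `F^r`-invariant polynomials to a finite field, continuity from an open kernel,
  entrywise maps of block matrices, products of block matrices with scalar blocks.

Everything is proved from the tree; no named fact is used.  Worker of lead
prover-line-stmt-Langlands-13640-c1-0 (2026-08-16).
-/

-- `Summit.Langlands.Langlands.…` (summit = sub-problem name, D-0017 layout) trips `dupNamespace` on every decl.
set_option linter.dupNamespace false

noncomputable section

open Polynomial Matrix
open Literature.NumberTheory.GaloisRepresentations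
open Literature.RepresentationTheory.Semisimple

namespace Summit.Langlands.Langlands.Cruxes.StableYoshidaCongruence.BurkhardtWeddleTwoThreeAnchor.ModelFp

variable {k : Type} [Field k] {G : Type} [Group G]

section Dichotomy

variable {p : ℕ} [Fact p.Prime] [CharP k p] [PerfectRing k p] [TopologicalSpace k]
  [DiscreteTopology k] [TopologicalSpace G] {n : ℕ}

omit [Fact p.Prime] [CharP k p] [PerfectRing k p] [DiscreteTopology k] in
/-- `det(X - ρ(g))` computed on the representation on `kⁿ` underlying a framed representation.
[folklore] -/
theorem charpoly_toRepresentation (ρ : FramedRep G k n) (g : G) :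
    (ρ.toRepresentation g).charpoly = FramedRep.charpoly ρ g :=
  charpoly_glStd_comp ρ.toMonoidHom g

/-- **The Frobenius dichotomy.**  Let `k` be a perfect field of characteristic `p` (discrete), `F`
its Frobenius, and `σ, σ' : G → GL₂(k)` irreducible framed representations such that every product
`det(X - σ(g)) det(X - σ'(g))` is `F`-invariant.  Then EITHER every `det(X - σ(g))` is `F`-invariant,
OR `F(det(X - σ(g))) = det(X - σ'(g))` for every `g`.  Proof: the Frobenius twists `σ^F, σ'^F` are
irreducible (`isIrreducible_map_of_surjective`) and `σ^F ⊕ σ'^F`, `σ ⊕ σ'` are semisimple with the same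
characteristic polynomials, hence equivalent by Brauer–Nesbitt (tree
`Representation.nonempty_equiv_of_charpoly_eq`); composing `σ^F ↪ σ^F ⊕ σ'^F ≃ σ ⊕ σ'` with the two
projections gives a non-zero `G`-map `σ^F → σ` or `σ^F → σ'`, an isomorphism by Schur
(Mathlib `Representation.IsIrreducible.bijective_or_eq_zero`). [folklore] -/
theorem frobenius_dichotomy (σ σ' : FramedRep G k 2) (hσ : σ.IsIrreducible) (hσ' : σ'.IsIrreducible)
    (h : ∀ g, (FramedRep.charpoly σ g * FramedRep.charpoly σ' g).map (frobenius k p) =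
      FramedRep.charpoly σ g * FramedRep.charpoly σ' g) :
    (∀ g, (FramedRep.charpoly σ g).map (frobenius k p) = FramedRep.charpoly σ g) ∨
      (∀ g, (FramedRep.charpoly σ g).map (frobenius k p) = FramedRep.charpoly σ' g) := by
  classical
  set F := frobenius k p with hFdef
  have hF : Continuous F := continuous_of_discreteTopology
  have hFs : Function.Surjective F := by
    rw [hFdef, ← coe_frobeniusEquiv]
    exact (frobeniusEquiv k p).surjective
  set σF := FramedRep.baseChange F hF σ with hσFdef
  set σ'F := FramedRep.baseChange F hF σ' with hσ'Fdef
  have hcF : ∀ g, FramedRep.charpoly σF g = (FramedRep.charpoly σ g).map F :=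
    FramedRep.charpoly_baseChange F hF σ
  have hcF' : ∀ g, FramedRep.charpoly σ'F g = (FramedRep.charpoly σ' g).map F :=
    FramedRep.charpoly_baseChange F hF σ'
  set R : Representation k G (Fin 2 → k) := σ.toRepresentation with hRdef
  set R' : Representation k G (Fin 2 → k) := σ'.toRepresentation with hR'def
  set RF : Representation k G (Fin 2 → k) := σF.toRepresentation with hRFdef
  set RF' : Representation k G (Fin 2 → k) := σ'F.toRepresentation with hRF'def
  haveI hR : R.IsIrreducible := hσ
  haveI hR' : R'.IsIrreducible := hσ'
  haveI hRF : RF.IsIrreducible := isIrreducible_map_of_surjective F hFs σ.toMonoidHom hσ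
  haveI hRF' : RF'.IsIrreducible := isIrreducible_map_of_surjective F hFs σ'.toMonoidHom hσ'
  haveI := isSemisimpleRepresentation_of_isIrreducible R hR
  haveI := isSemisimpleRepresentation_of_isIrreducible R' hR'
  haveI := isSemisimpleRepresentation_of_isIrreducible RF hRF
  haveI := isSemisimpleRepresentation_of_isIrreducible RF' hRF'
  have hc : ∀ g, ((RF.prod RF') g).charpoly = ((R.prod R') g).charpoly := by
    intro g
    change ((RF g).prodMap (RF' g)).charpoly = ((R g).prodMap (R' g)).charpoly
    rw [LinearMap.charpoly_prodMap, LinearMap.charpoly_prodMap, hRdef, hR'def, hRFdef, hRF'def,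
      charpoly_toRepresentation, charpoly_toRepresentation, charpoly_toRepresentation,
      charpoly_toRepresentation, hcF, hcF', ← Polynomial.map_mul, h]
  obtain ⟨e⟩ := Representation.nonempty_equiv_of_charpoly_eq (RF.prod RF') (R.prod R') hc
  set f := e.toIntertwiningMap.comp (Representation.IntertwiningMap.inl k RF RF') with hfdef
  set f₁ := (Representation.IntertwiningMap.fst k R R').comp f with hf₁def
  set f₂ := (Representation.IntertwiningMap.snd k R R').comp f with hf₂def
  have hf₁ : ∀ v, f₁ v = (e (v, 0)).1 := fun v => rfl
  have hf₂ : ∀ v, f₂ v = (e (v, 0)).2 := fun v => rfl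
  have hne : f₁ ≠ 0 ∨ f₂ ≠ 0 := by
    by_contra hcon
    push Not at hcon
    obtain ⟨h1, h2⟩ := hcon
    set v : Fin 2 → k := fun _ => 1 with hvdef
    have hv : e (v, 0) = 0 :=
      Prod.ext (by rw [← hf₁, h1]; rfl) (by rw [← hf₂, h2]; rfl)
    have hv0 : (v, (0 : Fin 2 → k)) = 0 := EquivLike.injective e (by rw [hv, map_zero])
    have := congr_fun (Prod.mk.inj hv0).1 0
    simp [hvdef] at this
  rcases hne with h1 | h2
  · left
    have hb := (Representation.IsIrreducible.bijective_or_eq_zero f₁).resolve_right h1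
    have e₁ := Representation.IntertwiningMap.ofBijective f₁ hb
    intro g
    have := (Representation.nonempty_equiv_iff_charpoly_eq RF R).mp ⟨e₁⟩ g
    rwa [hRFdef, hRdef, charpoly_toRepresentation, charpoly_toRepresentation, hcF] at this
  · right
    have hb := (Representation.IsIrreducible.bijective_or_eq_zero f₂).resolve_right h2
    have e₂ := Representation.IntertwiningMap.ofBijective f₂ hb
    intro g
    have := (Representation.nonempty_equiv_iff_charpoly_eq RF R').mp ⟨e₂⟩ g
    rwa [hRFdef, hR'def, charpoly_toRepresentation, charpoly_toRepresentation, hcF] at this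

end Dichotomy


/-! ## Small lemmas: lifting polynomials, continuity, block matrices -/

section Small

/-- A polynomial over a field `K` all of whose coefficients satisfy `c ^ q = c`, `q = #k₀`, comes
from `k₀[X]` along `j : k₀ → K` (tree `mem_range_iff_pow_card_eq`, Mathlib `Polynomial.lifts`).
[folklore] -/
theorem exists_map_eq_of_coeff_pow_card {k₀ : Type} [Field k₀] [Fintype k₀] {K : Type} [Field K]
    (j : k₀ →+* K) (P : K[X]) (hP : ∀ n, P.coeff n ^ Fintype.card k₀ = P.coeff n) :
    ∃ Q : k₀[X], Q.map j = P := by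
  have hl : P ∈ Polynomial.lifts j :=
    (Polynomial.lifts_iff_coeff_lifts P).mpr fun n => (mem_range_iff_pow_card_eq j _).mpr (hP n)
  exact (Polynomial.mem_lifts P).mp hl

variable [TopologicalSpace G] [IsTopologicalGroup G]

/-- A homomorphism of topological groups with open kernel is continuous (same statement as the tree's
`MonoidHom.continuous_of_isOpen_ker` in `GlobalArtinMapOfCharactersProofs`, restated to keep the
imports of this file light). [folklore] -/
theorem continuous_of_isOpen_ker {M : Type} [Group M] [TopologicalSpace M] [IsTopologicalGroup M]
    (f : G →* M) (hf : IsOpen (f.ker : Set G)) : Continuous f := by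
  refine continuous_of_continuousAt_one f ?_
  rw [ContinuousAt, map_one]
  refine Filter.tendsto_def.mpr fun W hW => Filter.mem_of_superset (hf.mem_nhds f.ker.one_mem) ?_
  intro x hx
  rw [Set.mem_preimage, (MonoidHom.mem_ker).mp hx]
  exact mem_of_mem_nhds hW

variable [TopologicalSpace k] [DiscreteTopology k]

/-- A homomorphism `f : G → M` killed by the common kernel of two continuous representations
`σ, σ' : G → GL₂(k)`, `k` DISCRETE, is continuous: its kernel contains the open subgroup
`ker σ ∩ ker σ'`. [folklore] -/
theorem continuous_of_ker_le {M : Type} [Group M] [TopologicalSpace M] [IsTopologicalGroup M]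
    (σ σ' : FramedRep G k 2) (f : G →* M) (h : ∀ g, σ g = 1 → σ' g = 1 → f g = 1) :
    Continuous f := by
  apply continuous_of_isOpen_ker
  have hopen : ∀ τ : FramedRep G k 2, IsOpen (τ.toMonoidHom.ker : Set G) := fun τ => by
    have h1 : (τ.toMonoidHom.ker : Set G) = τ ⁻¹' {1} := by
      ext g
      simp [MonoidHom.mem_ker]
    rw [h1]
    exact (isOpen_discrete _).preimage τ.continuous_toFun
  have h2 : IsOpen ((σ.toMonoidHom.ker ⊓ σ'.toMonoidHom.ker : Subgroup G) : Set G) :=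
    (hopen σ).inter (hopen σ')
  refine Subgroup.isOpen_mono (fun g hg => ?_) h2
  rw [Subgroup.mem_inf, MonoidHom.mem_ker, MonoidHom.mem_ker] at hg
  exact h g hg.1 hg.2

omit [TopologicalSpace G] [IsTopologicalGroup G] [TopologicalSpace k] [DiscreteTopology k] in
/-- Entrywise maps commute with block-diagonal reindexed matrices. [folklore] -/
theorem map_reindex_fromBlocks_zero {k' : Type} [Field k'] (f : k →+* k') {m n : ℕ}
    (e : Fin m ⊕ Fin m ≃ Fin n) (A D : Matrix (Fin m) (Fin m) k) :
    (Matrix.reindex e e (Matrix.fromBlocks A 0 0 D)).map f =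
      Matrix.reindex e e (Matrix.fromBlocks (A.map f) 0 0 (D.map f)) := by
  rw [Matrix.reindex_apply, Matrix.reindex_apply, ← Matrix.submatrix_map, Matrix.fromBlocks_map,
    Matrix.map_zero _ (map_zero f)]

omit [TopologicalSpace G] [IsTopologicalGroup G] [TopologicalSpace k] [DiscreteTopology k] in
/-- Products of block matrices all of whose blocks are scalar. [folklore] -/
theorem fromBlocks_smul_one_mul_fromBlocks_smul_one {m : Type} [Fintype m] [DecidableEq m]
    (a b c d a' b' c' d' : k) :
    (Matrix.fromBlocks (a • (1 : Matrix m m k)) (b • (1 : Matrix m m k)) (c • (1 : Matrix m m k))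
        (d • (1 : Matrix m m k))) *
        Matrix.fromBlocks (a' • (1 : Matrix m m k)) (b' • (1 : Matrix m m k))
          (c' • (1 : Matrix m m k)) (d' • (1 : Matrix m m k)) =
      Matrix.fromBlocks ((a * a' + b * c') • (1 : Matrix m m k))
        ((a * b' + b * d') • (1 : Matrix m m k)) ((c * a' + d * c') • (1 : Matrix m m k))
        ((c * b' + d * d') • (1 : Matrix m m k)) := by
  simp only [Matrix.fromBlocks_multiply, Matrix.smul_mul, Matrix.mul_smul, Matrix.one_mul, smul_smul,
    ← add_smul]
  congr 2 <;> ring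

end Small

/-! ## Case A: both constituents `𝔽_p`-rational -/

section CaseA

variable {p : ℕ} [Fact p.Prime] [CharP k p] [TopologicalSpace k] [DiscreteTopology k]
  [TopologicalSpace G] [IsTopologicalGroup G]

/-- **Case A of the descent.**  If `σ, σ' : G → GL₂(k)` are continuous (`k` discrete of
characteristic `p`), irreducible, and every `det(X - σ(g))`, `det(X - σ'(g))` is Frobenius-invariant,
then there is a continuous `ρb : G → GL₄(𝔽_p)` with `ρb ⊗ k` conjugate to `σ ⊕ σ'`: descend `σ`, `σ'`
to `GL₂(𝔽_p)` with the same characteristic polynomials (Deligne–Serre 6.13 for `n = 2`, tree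
`exists_descent_fin_two`), take the block sum (tree `exists_blockDiag_hom`; continuity from the open
kernels), and conjugate by `exists_conj_blockDiag`. [cite: DeligneSerreASENS1974, Lemme 6.13] -/
theorem exists_model_of_frobenius_fixed :
    ∀ {k : Type} [Field k] {G : Type} [Group G] {p : ℕ} [Fact p.Prime] [CharP k p]
      [TopologicalSpace k] [DiscreteTopology k] [TopologicalSpace G] [IsTopologicalGroup G]
      (σ σ' : FramedRep G k 2), σ.IsIrreducible → σ'.IsIrreducible →
      (∀ g, (FramedRep.charpoly σ g).map (frobenius k p) = FramedRep.charpoly σ g) →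
      (∀ g, (FramedRep.charpoly σ' g).map (frobenius k p) = FramedRep.charpoly σ' g) →
      ∃ (ρb : FramedRep G (ZMod p) 4) (P : GL (Fin 4) k), ∀ g,
        ((P⁻¹ * FramedRep.baseChange (ZMod.castHom (dvd_refl p) k) continuous_of_discreteTopology ρb g *
            P : GL (Fin 4) k) : Matrix (Fin 4) (Fin 4) k) =
          Matrix.reindex finSumFinEquiv finSumFinEquiv
            (Matrix.fromBlocks ((σ g : GL (Fin 2) k) : Matrix (Fin 2) (Fin 2) k) 0 0
              ((σ' g : GL (Fin 2) k) : Matrix (Fin 2) (Fin 2) k)) := by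
  intro k _ G _ p _ _ _ _ _ _ σ σ' hσ hσ' h h'
  classical
  set c := ZMod.castHom (dvd_refl p) k with hcdef
  have hcoeff : ∀ (P : k[X]), P.map (frobenius k p) = P →
      ∀ n, P.coeff n ^ Fintype.card (ZMod p) = P.coeff n := by
    intro P hP n
    rw [ZMod.card, ← frobenius_def, ← Polynomial.coeff_map, hP]
  have hQ : ∀ g, ∃ Q : (ZMod p)[X], Q.map c =
      ((σ.toMonoidHom g : GL (Fin 2) k) : Matrix (Fin 2) (Fin 2) k).charpoly := fun g =>
    exists_map_eq_of_coeff_pow_card c _ (hcoeff _ (h g))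
  have hQ' : ∀ g, ∃ Q : (ZMod p)[X], Q.map c =
      ((σ'.toMonoidHom g : GL (Fin 2) k) : Matrix (Fin 2) (Fin 2) k).charpoly := fun g =>
    exists_map_eq_of_coeff_pow_card c _ (hcoeff _ (h' g))
  obtain ⟨ρ₁, hker₁, hchar₁⟩ := exists_descent_fin_two c σ.toMonoidHom hQ
  obtain ⟨ρ₂, hker₂, hchar₂⟩ := exists_descent_fin_two c σ'.toMonoidHom hQ'
  obtain ⟨ρ₀, hρ₀⟩ := exists_blockDiag_hom (k := ZMod p) (finSumFinEquiv : Fin 2 ⊕ Fin 2 ≃ Fin 4) ρ₁ ρ₂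
  have hcont : Continuous ρ₀ := by
    refine continuous_of_ker_le σ σ' ρ₀ fun g hg hg' => ?_
    have h1 : ρ₁ g = 1 := hker₁ (show σ.toMonoidHom g = 1 from hg)
    have h2 : ρ₂ g = 1 := hker₂ (show σ'.toMonoidHom g = 1 from hg')
    refine Units.ext ?_
    rw [hρ₀ g, h1, h2, Units.val_one, Units.val_one, Matrix.fromBlocks_one, Matrix.reindex_apply,
      Matrix.submatrix_one_equiv]
  let ρb : FramedRep G (ZMod p) 4 := ⟨ρ₀, hcont⟩
  set ψ₁ : G →* GL (Fin 2) k := (Matrix.GeneralLinearGroup.map c).comp ρ₁ with hψ₁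
  set ψ₂ : G →* GL (Fin 2) k := (Matrix.GeneralLinearGroup.map c).comp ρ₂ with hψ₂
  set D : G →* GL (Fin 4) k :=
    (FramedRep.baseChange c continuous_of_discreteTopology ρb).toMonoidHom with hDdef
  have hD : ∀ g, ((D g : GL (Fin 4) k) : Matrix (Fin 4) (Fin 4) k) =
      Matrix.reindex finSumFinEquiv finSumFinEquiv
        (Matrix.fromBlocks ((ψ₁ g : GL (Fin 2) k) : Matrix (Fin 2) (Fin 2) k) 0 0
          ((ψ₂ g : GL (Fin 2) k) : Matrix (Fin 2) (Fin 2) k)) := by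
    intro g
    change (((ρ₀ g : GL (Fin 4) (ZMod p)) : Matrix (Fin 4) (Fin 4) (ZMod p))).map c = _
    rw [hρ₀ g, map_reindex_fromBlocks_zero]
    rfl
  have h₁ : ∀ g, ((ψ₁ g : GL (Fin 2) k) : Matrix (Fin 2) (Fin 2) k).charpoly =
      ((σ.toMonoidHom g : GL (Fin 2) k) : Matrix (Fin 2) (Fin 2) k).charpoly := by
    intro g
    rw [← hchar₁ g, ← Matrix.charpoly_map]
    rfl
  have h₂ : ∀ g, ((ψ₂ g : GL (Fin 2) k) : Matrix (Fin 2) (Fin 2) k).charpoly =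
      ((σ'.toMonoidHom g : GL (Fin 2) k) : Matrix (Fin 2) (Fin 2) k).charpoly := by
    intro g
    rw [← hchar₂ g, ← Matrix.charpoly_map]
    rfl
  obtain ⟨Q, hQc⟩ := exists_conj_blockDiag σ.toMonoidHom σ'.toMonoidHom ψ₁ ψ₂ hσ hσ' h₁ h₂ D hD
  exact ⟨ρb, Q, fun g => hQc g⟩

end CaseA

end Summit.Langlands.Langlands.Cruxes.StableYoshidaCongruence.BurkhardtWeddleTwoThreeAnchor.ModelFp

end
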